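import Mathlib
import Literature.MathematicalPhysics.QuantumFieldTheory.Balaban1983to89.B6Geometry
import Literature.MathematicalPhysics.QuantumFieldTheory.Balaban1983to89.B6Lemma21Arith

/-!
# `Balaban1983to89.B6Lemma21Repaired` — Lemma 2.1 of B6 with the REPAIRED constant c₁′(α) = 13 c₀(½α)^{3d}:
the constant made generic in (2.61)–(2.63), the printed "hence" re-derived for any constant, and the repaired
statement assembled from (2.60) (kernel, `B6Geometry`) and the repaired row-sum bound (2.61′)

CITATION HEADER (lean-in-tree rule 2026-08-18). Source: T. Bałaban, *Propagators and renormalization transformations for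
lattice gauge theories. II*, Comm. Math. Phys. **96**, 223–250 (1984) [Balaban1984PropagatorsII] (cell paper B6; PDF
`paper:balaban1984-cmp96-propagators-rt-ii`, journal page = PDF page + 222; renders
`b2b-balaban-ref1/pages/1984-cmp96-propagators-rt-II/…-p011/p012-x2.png` = pp. 233–234).

CONTEXT (adversarial reader 1, gens 6–7). The printed Lemma 2.1 (p. 234) asserts (2.61) «sup_y Σ_{y′∈𝔅} e^{−αδ₀d(y,y′)}
≤ c₁(α)» with c₁(α) = 12c₀^d(½α). The sibling module `B6Lemma21Counterexample` shows this constant is EXCEEDED in d = 4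
(the last contour piece in the proof of (2.58) carries no factor e^{−½αδ₀RM}; GAPS G-A11-1), and `B6Lemma21Arith` v2 shows
that the repaired geometric bound (2.58′) gives, under the SAME condition (2.59), the constant
`B6Lemma21Arith.c1Repaired d δ₀ α = 13 c₀(½α)^{3d}` (`ineq258Repaired_sum_le`; GAPS G-A12-1, C-A12-1).
The sibling modules `B6` (`B6.c1`, `B6.Lemma21Printed`), `B6RandomWalk` (`Ineq261`–`Ineq263`, `lemma21_full`) and
`B6Geometry` (`lemma21Printed_of_ineq261`) hard-wire the printed `B6.c1`; none of them is modified here.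

WHAT IS REPRODUCED (kernel-checked, no `sorry`):
* `Ineq261With c g δ₀ α`, `Ineq262With c …`, `Ineq263With c …`: the displays (2.61)–(2.63) of Lemma 2.1 with the constant
  c₁(α) replaced by an arbitrary real `c` (`B6RandomWalk.Ineq26k d g δ₀ α ↔ Ineq26kWith (B6.c1 d δ₀ α) g δ₀ α` by `Iff.rfl`,
  recorded in `ineq261_iff_with` etc.);
* the printed "hence" for ANY constant: `ineq262With_of_261With` ((2.61) ⇒ (2.62)), `ineq263With_of_261With`
  ((2.61) + (2.54) ⇒ (2.63)) — the proofs are the sibling's `openChain_le_pow` / `chain_split`, which were already generic;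
* monotonicity `ineq261With_mono` (a (2.61) with a smaller constant implies one with a larger constant) and
  `c1_le_c1Repaired` (imported): every consumer written against the printed c₁ is implied a fortiori by the repaired form;
* `Lemma21Repaired d δ₀ geo`: the statement of Lemma 2.1 VERBATIM except c₁ ↦ c₁′ = `c1Repaired` (same (2.1)–(2.2),
  0 < α < 1, (2.59) hypotheses; (2.60) unchanged); `lemma21Printed_imp_repaired` (the printed statement would imply it —
  vacuous for d ≥ 3 by G-A11-1, recorded for bookkeeping); `lemma21Repaired_of_ineq261R`: the repaired statement FOLLOWS
  from (2.60) (kernel: `B6Geometry.ineq260_of_levelGap`, for geometries realized by a contour system with the walk form of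
  (2.2)) and the repaired row-sum bound (2.61′) = `Ineq261With (c1Repaired d δ₀ α)` — the ONLY remaining analytic leaf;
* `lemma21Repaired_full`: all four displays (2.60)–(2.63) with c₁′ from `Lemma21Repaired` + the triangle inequality (2.54).
WHAT IS NOT REPRODUCED: (2.61′) itself, i.e. the geometric count (2.54)–(2.57) ⇒ (2.58′) (the sum (2.58′) is bounded by
13c₀^{3d} in `B6Lemma21Arith.ineq258Repaired_sum_le`; that Σ_{y′} e^{−αδ₀d(y,y′)} is bounded by the sum (2.58′) is the
repaired print argument p. 233 with (2.57) for l = 1, …, m − 1 only, not formalised — see G-A11-1 for the residual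
"surface points are L^{j_l}η-sites" caveat).
-/

namespace Literature.MathematicalPhysics.QuantumFieldTheory.Balaban1983to89.B6Lemma21Repaired

open Literature.MathematicalPhysics.QuantumFieldTheory.Balaban1983to89
open Finset

/-! ## (2.61)–(2.63) with a generic constant -/

/-- (2.61) with an arbitrary constant `c` in place of c₁(α): `sup_y Σ_{y′∈𝔅} e^{−αδ₀d(y,y′)} ≤ c`.
[cite: Balaban1984PropagatorsII, (2.61) p.234] -/
def Ineq261With (c : ℝ) (g : B6.Geometry) (δ₀ α : ℝ) : Prop :=
  ∀ y : g.Site, ∑ y' : g.Site, Real.exp (-(α * δ₀ * g.dist y y')) ≤ c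

/-- (2.62) with an arbitrary constant `c`: the open chain with `m + 1` factors is `≤ c^{m+1}`.
[cite: Balaban1984PropagatorsII, (2.62) p.234] -/
def Ineq262With (c : ℝ) (g : B6.Geometry) (δ₀ α : ℝ) : Prop :=
  ∀ (m : ℕ) (y : g.Site),
    B6RandomWalk.openChain (fun a b : g.Site => Real.exp (-(α * δ₀ * g.dist a b))) m y ≤ c ^ (m + 1)

/-- (2.63) with an arbitrary constant `c`: the closed chain at rate δ₀ is `≤ c^{m+1} e^{−(1−α)δ₀d(y,y′)}`.
[cite: Balaban1984PropagatorsII, (2.63) p.234] -/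
def Ineq263With (c : ℝ) (g : B6.Geometry) (δ₀ α : ℝ) : Prop :=
  ∀ (m : ℕ) (y y' : g.Site),
    B6RandomWalk.chain (fun a b : g.Site => Real.exp (-(δ₀ * g.dist a b))) m y y' ≤
      c ^ (m + 1) * Real.exp (-((1 - α) * δ₀ * g.dist y y'))

/-- The sibling's printed (2.61) is the generic form at `c = B6.c1`. [folklore] -/
theorem ineq261_iff_with (d : ℕ) (g : B6.Geometry) (δ₀ α : ℝ) :
    B6RandomWalk.Ineq261 d g δ₀ α ↔ Ineq261With (B6.c1 d δ₀ α) g δ₀ α := Iff.rfl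

/-- The sibling's printed (2.62) is the generic form at `c = B6.c1`. [folklore] -/
theorem ineq262_iff_with (d : ℕ) (g : B6.Geometry) (δ₀ α : ℝ) :
    B6RandomWalk.Ineq262 d g δ₀ α ↔ Ineq262With (B6.c1 d δ₀ α) g δ₀ α := Iff.rfl

/-- The sibling's printed (2.63) is the generic form at `c = B6.c1`. [folklore] -/
theorem ineq263_iff_with (d : ℕ) (g : B6.Geometry) (δ₀ α : ℝ) :
    B6RandomWalk.Ineq263 d g δ₀ α ↔ Ineq263With (B6.c1 d δ₀ α) g δ₀ α := Iff.rfl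

/-- Monotonicity in the constant. [folklore] -/
theorem ineq261With_mono {c c' : ℝ} (hcc : c ≤ c') {g : B6.Geometry} {δ₀ α : ℝ}
    (h : Ineq261With c g δ₀ α) : Ineq261With c' g δ₀ α :=
  fun y => le_trans (h y) hcc

/-- The printed "hence", first half, for any constant: (2.61) ⇒ (2.62). [cite: Balaban1984PropagatorsII, Lemma 2.1 p.234] -/
theorem ineq262With_of_261With {c : ℝ} {g : B6.Geometry} {δ₀ α : ℝ} (h261 : Ineq261With c g δ₀ α) :
    Ineq262With c g δ₀ α :=
  fun m y => B6RandomWalk.openChain_le_pow _ (fun _ _ => Real.exp_nonneg _) _ h261 m y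

/-- The printed "hence", second half, for any constant: (2.61) + (2.54) ⇒ (2.63) (inputs: triangle inequality,
0 ≤ δ₀, α ≤ 1; no lower bound on the constant). [cite: Balaban1984PropagatorsII, Lemma 2.1 p.234 + (2.54)–(2.56) p.233] -/
theorem ineq263With_of_261With {c : ℝ} {g : B6.Geometry} {δ₀ α : ℝ} (htri : B6RandomWalk.Triangle254 g)
    (hδ : 0 ≤ δ₀) (hα : α ≤ 1) (h261 : Ineq261With c g δ₀ α) : Ineq263With c g δ₀ α := by
  intro m y y'
  have hsplit := B6RandomWalk.chain_split g.dist htri δ₀ α (mul_nonneg (by linarith) hδ) m y y'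
  have hopen : B6RandomWalk.chain (fun a b : g.Site => Real.exp (-(α * δ₀ * g.dist a b))) m y y' ≤ c ^ (m + 1) :=
    le_trans (B6RandomWalk.chain_le_openChain _ (fun _ _ => Real.exp_nonneg _) m y y')
      (ineq262With_of_261With h261 m y)
  calc B6RandomWalk.chain (fun a b : g.Site => Real.exp (-(δ₀ * g.dist a b))) m y y'
      ≤ Real.exp (-((1 - α) * δ₀ * g.dist y y')) *
          B6RandomWalk.chain (fun a b : g.Site => Real.exp (-(α * δ₀ * g.dist a b))) m y y' := hsplit
    _ ≤ Real.exp (-((1 - α) * δ₀ * g.dist y y')) * c ^ (m + 1) :=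
        mul_le_mul_of_nonneg_left hopen (Real.exp_nonneg _)
    _ = c ^ (m + 1) * Real.exp (-((1 - α) * δ₀ * g.dist y y')) := mul_comm _ _

/-! ## Lemma 2.1 with the repaired constant -/

/-- **Lemma 2.1, REPAIRED** (p. 234 with c₁(α) = 12c₀^d(½α) replaced by c₁′(α) = 13c₀^{3d}(½α) =
`B6Lemma21Arith.c1Repaired`; the printed hypotheses «α, 0 < α < 1, … RM satisfying (2.59)» verbatim, with the section
hypotheses (2.1)–(2.2) as in `B6.Lemma21Printed`; ⇒ (2.60) ∧ (2.61′); docstring fixed after GAPS G-ref1-14 (b)). The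
printed form `B6.Lemma21Printed` is refuted for d ≥ 3 (`B6Lemma21Counterexample`, GAPS G-A11-1); this is the statement the
repaired proof supports (GAPS G-A12-1). [cite: Balaban1984PropagatorsII, Lemma 2.1 (2.60)–(2.61) p.234; repaired] -/
def Lemma21Repaired {I : Type} (d : ℕ) (δ₀ : ℝ) (geo : I → B6.Geometry) : Prop :=
  ∀ i : I, (geo i).Hyp21_22 → ∀ α : ℝ, 0 < α → α < 1 → B6.Cond259 d δ₀ α (geo i).R (geo i).M →
    B6RandomWalk.Ineq260 (geo i) δ₀ α ∧ Ineq261With (B6Lemma21Arith.c1Repaired d δ₀ α) (geo i) δ₀ α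

/-- Bookkeeping: the printed statement implies the repaired one (c₁ ≤ c₁′). Recorded only to fix the direction of the
constants; the antecedent is false for d ≥ 3 (G-A11-1). [folklore] -/
theorem lemma21Printed_imp_repaired {I : Type} (d : ℕ) (δ₀ : ℝ) (hδ : 0 < δ₀) (geo : I → B6.Geometry)
    (h : B6.Lemma21Printed d δ₀ geo) : Lemma21Repaired d δ₀ geo := by
  intro i hH α hα0 hα1 hcond
  obtain ⟨h260, h261⟩ := (B6RandomWalk.lemma21Printed_iff d δ₀ geo).mp h i hH α hα0 hα1 hcond
  exact ⟨h260, ineq261With_mono (B6Lemma21Arith.c1_le_c1Repaired hα0 hδ) h261⟩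

/-- **The repaired Lemma 2.1 from (2.61′) alone**: for a family of geometries each realized by a contour system with the
walk form of (2.2) (N_i ≥ R_iM_i bonds), (2.60) is kernel-derived (`B6Geometry.ineq260_of_levelGap`) and the repaired
row-sum bound (2.61′) with c₁′ = `c1Repaired` is the ONLY analytic leaf. [cite: Balaban1984PropagatorsII, Lemma 2.1 p.234;
repaired] -/
theorem lemma21Repaired_of_ineq261R {I : Type} (d : ℕ) (δ₀ : ℝ) (hδ : 0 ≤ δ₀) (geo : I → B6.Geometry)
    (C : ∀ i, B6Geometry.ContourSystem (geo i)) (N : I → ℕ)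
    (hreal : ∀ i, B6Geometry.Realizes (geo i) (C i)) (hconn : ∀ i, (C i).bond.Connected)
    (hgap : ∀ i, B6Geometry.LevelGap (C i).bond (C i).zone (N i))
    (hRM : ∀ i, (geo i).R * (geo i).M ≤ N i)
    (h261R : ∀ i : I, (geo i).Hyp21_22 → ∀ α : ℝ, 0 < α → α < 1 →
      B6.Cond259 d δ₀ α (geo i).R (geo i).M → Ineq261With (B6Lemma21Arith.c1Repaired d δ₀ α) (geo i) δ₀ α) :
    Lemma21Repaired d δ₀ geo := by
  intro i hH α hα0 hα1 hcond
  exact ⟨B6Geometry.ineq260_of_levelGap (hreal i) (hconn i) (hgap i) (hRM i) (mul_nonneg hα0.le hδ),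
    h261R i hH α hα0 hα1 hcond⟩

/-- **Repaired Lemma 2.1 with its "hence" discharged**: all four displays (2.60)–(2.63) with c₁′ = `c1Repaired`, from
`Lemma21Repaired` and the triangle inequality (2.54). [cite: Balaban1984PropagatorsII, Lemma 2.1 (2.60)–(2.63) p.234;
repaired] -/
theorem lemma21Repaired_full {I : Type} (d : ℕ) (δ₀ : ℝ) (hδ : 0 ≤ δ₀) (geo : I → B6.Geometry)
    (htri : ∀ i, B6RandomWalk.Triangle254 (geo i)) (h : Lemma21Repaired d δ₀ geo) :
    ∀ i : I, (geo i).Hyp21_22 → ∀ α : ℝ, 0 < α → α < 1 → B6.Cond259 d δ₀ α (geo i).R (geo i).M →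
      B6RandomWalk.Ineq260 (geo i) δ₀ α ∧
        Ineq261With (B6Lemma21Arith.c1Repaired d δ₀ α) (geo i) δ₀ α ∧
        Ineq262With (B6Lemma21Arith.c1Repaired d δ₀ α) (geo i) δ₀ α ∧
        Ineq263With (B6Lemma21Arith.c1Repaired d δ₀ α) (geo i) δ₀ α := by
  intro i hH α hα0 hα1 hcond
  obtain ⟨h260, h261⟩ := h i hH α hα0 hα1 hcond
  exact ⟨h260, h261, ineq262With_of_261With h261, ineq263With_of_261With (htri i) hδ hα1.le h261⟩

/-- The repaired constant is non-negative (so `c ^ (m+1)` bounds behave). [folklore] -/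
theorem c1Repaired_nonneg (d : ℕ) (δ₀ α : ℝ) : 0 ≤ B6Lemma21Arith.c1Repaired d δ₀ α := by
  unfold B6Lemma21Arith.c1Repaired
  have := B6RandomWalk.c0_nonneg δ₀ (α / 2)
  positivity

end Literature.MathematicalPhysics.QuantumFieldTheory.Balaban1983to89.B6Lemma21Repaired
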